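import Summits.BirchSwinnertonDyer.BirchSwinnertonDyer.Theorems.Rank2ObservatoryRank3PSatCertCL
import HarnessLib

/-!
# BirchSwinnertonDyer — rank ≥ 2 observatory: rank-3 `p`-saturation certificates, lane `u ≥ 1`

HONEST FRAMING: per-curve certified theorems and census instruments; no claim on BSD in rank ≥ 2.

The lane-`u = 0` instrument (`Rank2ObservatoryRank3PSatCert[C|CL]`) needs `p ∤ t` for the torsion
annihilator `t`: then every torsion element is a `p`-th multiple of a torsion element and a witness
`k • R̃ ≠ O` at a good prime `q` with `#Ẽ(𝔽_q) = p·k` shows `R ∉ p•E(ℚ) = pCoset _ p 0`. When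
`p ∣ t` (the 32 rows of the rank-3 table with rational `3`-torsion) the target subgroup is
`p•E(ℚ) + E(ℚ)[p^u] = pCoset _ p u` with `t = p^u · m`, `p ∤ m`
(`listedSpan_saturated_of_not_mem_pCoset`, landed for every `u`). This file is the cheapest
witness for that subgroup — DEEP PRIMES: a good prime `q` with `p^(u+1) ∣ #Ẽ(𝔽_q) = p·k`; then
`p^u ∣ k`, so `k` kills `p•Ẽ(𝔽_q)` (Lagrange) AND `Ẽ(𝔽_q)[p^u]`, hence the whole reduction of
`p•E(ℚ) + E(ℚ)[p^u]`, and the SAME three-generator chain `k • (aP̃₁ + bP̃₂ + cP̃₃) ≠ O` as in lane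
`u = 0` is a witness. Contents:

* `not_mem_pCoset_of_nsmul_ne_zero'` (`p^u ∣ k`, any `u`), `not_mem_pCoset_of_chain3`;
* `pWitnessU` = `pWitnessC` + `p^(u+1) ∣ N`, soundness `not_mem_pCoset_of_pWitnessU`;
* `pSaturated_of_certPU` (`t = p^u·m`, `p ∤ m`), the row datum `Rank3PSatCertU` (= exponent `u` +
  the dense datum `Rank3PSatCertC`), the row Boolean `rank3PSatCheckU` (counts by `killerLB`),
  `Rank3Row.pSaturated_of_pSatCheckU`, list form `rank3PSatCheckUAll`,
  **`Rank3Row.pSaturated_of_pSatCheckUAll`** — same conclusion shape as lane `u = 0`, so the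
  census glue is unchanged.

Scope note (engine side, `dry_lane_u.py`): at `p = 3` deep primes serve all 13 classes for 20 of
the 32 rows; for the 12 curves that are `3`-isogenous images `E' = E/⟨T⟩` one class (the image of
`E(ℚ)`) is locally divisible at every prime of `3`-rank one and needs a different witness (rational
`3`-torsion point + a full-`3`-torsion prime; not in this file). Sorry-free; no `decide` executed
here; no instances, no notation.

References: S. Siksek, Rocky Mountain J. Math. 25 (1995) §3; J. E. Cremona, *Algorithms for
Modular Elliptic Curves* (1997) §3.5; J. H. Silverman, AEC (2009) VII.3.1(b).
-/

-- single-conjunct summit: `Summit.BirchSwinnertonDyer.BirchSwinnertonDyer.…` repeats the name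
set_option linter.dupNamespace false

namespace Summit.BirchSwinnertonDyer.BirchSwinnertonDyer.Rank2Observatory

open WeierstrassCurve

/-! ### The deep-prime witness in an abstract group -/

/-- **Deep-prime witness.** In a group `B` killed by `p · k` with `p^u ∣ k`, an element `y` with
`k • y ≠ 0` does not lie in `p•B + B[p^u]`: if `y = p • b + c` with `p^u • c = 0` then
`k • y = (p k) • b + (k/p^u) • (p^u • c) = 0`. [folklore] -/
theorem not_mem_pCoset_of_nsmul_ne_zero' {B : Type*} [AddCommGroup B] {p u k : ℕ} {y : B}
    (hkill : ∀ b : B, (p * k) • b = 0) (hu : p ^ u ∣ k) (hy : k • y ≠ 0) :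
    y ∉ pCoset B p u := by
  rintro ⟨b, c, hc, rfl⟩
  obtain ⟨j, rfl⟩ := hu
  apply hy
  have h1 : (p ^ u * j) • ((p : ℤ) • b) = 0 := by
    rw [natCast_zsmul, smul_smul]
    have e : p ^ u * j * p = p * (p ^ u * j) := by ring
    rw [e]
    exact hkill b
  have h2 : (p ^ u * j) • c = 0 := by
    rw [mul_comm, mul_smul, ← natCast_zsmul c (p ^ u), Nat.cast_pow, hc, smul_zero]
  rw [smul_add, h1, h2, add_zero]

section Witness

variable (V : WeierstrassCurve ℤ) (q : ℕ) [Fact q.Prime]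

open scoped Classical in
/-- **The `p`-saturation witness at a DEEP good prime `q`** (`#Ẽ(𝔽_q) = p · k`, `p^u ∣ k`): a
checked three-generator chain reaching `(k a, k b, k c)` shows
`aP₁ + bP₂ + cP₃ ∉ p•E(ℚ) + E(ℚ)[p^u] = pCoset E(ℚ) p u` (as `not_mem_pCoset_zero_of_chain3`,
with `not_mem_pCoset_of_nsmul_ne_zero'`). [cite: SilvermanAEC2009, VII.3] -/
theorem not_mem_pCoset_of_chain3 (hq : ¬ (q : ℤ) ∣ V.Δ) {p u k : ℕ}
    (hN : zmodPointCount V q = p * k) (hu : p ^ u ∣ k)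
    {P₁ P₂ P₃ : (V.map (Int.castRingHom ℚ)).toAffine.Point} {x₁ y₁ x₂ y₂ x₃ y₃ : ZMod q}
    (h₁ : (V.map (Int.castRingHom (ZMod q))).toAffine.Nonsingular x₁ y₁)
    (h₂ : (V.map (Int.castRingHom (ZMod q))).toAffine.Nonsingular x₂ y₂)
    (h₃ : (V.map (Int.castRingHom (ZMod q))).toAffine.Nonsingular x₃ y₃)
    (hP₁ : reduceMod V q hq P₁ = .some x₁ y₁ h₁) (hP₂ : reduceMod V q hq P₂ = .some x₂ y₂ h₂)
    (hP₃ : reduceMod V q hq P₃ = .some x₃ y₃ h₃) {a b c : ℤ} (s₀ : Op)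
    {steps : List (Op × ZMod q × ZMod q)}
    (hc : chain3B V q (x₁, y₁) (x₂, y₂) (x₃, y₃) (startPt (x₁, y₁) (x₂, y₂) (x₃, y₃) s₀) steps
      = true)
    (hk : chain3Coeffs (startCoeffs s₀) steps = ((k : ℤ) * a, (k : ℤ) * b, (k : ℤ) * c)) :
    a • P₁ + b • P₂ + c • P₃ ∉ pCoset (V.map (Int.castRingHom ℚ)).toAffine.Point p u := by
  refine not_mem_pCoset_of_map_not_mem (reduceMod V q hq) ?_
  rw [map_add, map_add, map_zsmul, map_zsmul, map_zsmul, hP₁, hP₂, hP₃]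
  refine not_mem_pCoset_of_nsmul_ne_zero' (k := k) (fun y => ?_) hu ?_
  · rw [← hN, ← natCard_point_eq_zmodPointCount V q hq]
    exact card_nsmul_eq_zero'
  · have e : k •
          (a • (Affine.Point.some x₁ y₁ h₁ : (V.map (Int.castRingHom (ZMod q))).toAffine.Point)
          + b • Affine.Point.some x₂ y₂ h₂ + c • Affine.Point.some x₃ y₃ h₃) =
        ((k : ℤ) * a) • Affine.Point.some x₁ y₁ h₁ + ((k : ℤ) * b) • Affine.Point.some x₂ y₂ h₂
          + ((k : ℤ) * c) • Affine.Point.some x₃ y₃ h₃ := by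
      module
    rw [e]
    have hne := combo_ne_zero_of_chain3B V q h₁ h₂ h₃ s₀ hc
    rwa [hk] at hne

end Witness

/-! ### One class at one deep prime -/

/-- DEEP-PRIME WITNESS CHECK for the class `(a, b, c)` at the certified count `(q, N)`:
`p^(u+1) ∣ N` and the computed, validated chain of `pWitnessC` (`N = p·k`, joint plan for
`(ka, kb, kc)`). [cite: CremonaAlgorithms1997, §3.5] -/
def pWitnessU (V : WeierstrassCurve ℤ) (p u : ℕ) (X₁ Y₁ X₂ Y₂ X₃ Y₃ : ℤ) (abc : ℤ × ℤ × ℤ)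
    (qN : ℕ × ℕ) : Bool :=
  decide (p ^ (u + 1) ∣ qN.2) && pWitnessC V p X₁ Y₁ X₂ Y₂ X₃ Y₃ abc qN

open scoped Classical in
/-- **Soundness of the deep-prime witness**: `aP₁ + bP₂ + cP₃ ∉ p•E'(ℚ) + E'(ℚ)[p^u]` for the
integral points `Pᵢ = (Xᵢ, Yᵢ)` of `E' = V` (`not_mem_pCoset_of_chain3`).
[cite: SilvermanAEC2009, VII.3] -/
theorem not_mem_pCoset_of_pWitnessU (V : WeierstrassCurve ℤ) (hΔ : V.Δ ≠ 0) {p u q N : ℕ}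
    (hqN : killerB V (q, N) = true) {X₁ Y₁ X₂ Y₂ X₃ Y₃ : ℤ}
    (e₁ : Y₁ ^ 2 + V.a₁ * X₁ * Y₁ + V.a₃ * Y₁ = X₁ ^ 3 + V.a₂ * X₁ ^ 2 + V.a₄ * X₁ + V.a₆)
    (e₂ : Y₂ ^ 2 + V.a₁ * X₂ * Y₂ + V.a₃ * Y₂ = X₂ ^ 3 + V.a₂ * X₂ ^ 2 + V.a₄ * X₂ + V.a₆)
    (e₃ : Y₃ ^ 2 + V.a₁ * X₃ * Y₃ + V.a₃ * Y₃ = X₃ ^ 3 + V.a₂ * X₃ ^ 2 + V.a₄ * X₃ + V.a₆)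
    {a b c : ℤ} (hw : pWitnessU V p u X₁ Y₁ X₂ Y₂ X₃ Y₃ (a, b, c) (q, N) = true) :
    a • (Affine.Point.some (X₁ : ℚ) (Y₁ : ℚ) (nonsingular_rat_of_eq V hΔ e₁) :
        (V.map (Int.castRingHom ℚ)).toAffine.Point)
      + b • Affine.Point.some (X₂ : ℚ) (Y₂ : ℚ) (nonsingular_rat_of_eq V hΔ e₂)
      + c • Affine.Point.some (X₃ : ℚ) (Y₃ : ℚ) (nonsingular_rat_of_eq V hΔ e₃) ∉
      pCoset (V.map (Int.castRingHom ℚ)).toAffine.Point p u := by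
  rw [pWitnessU, Bool.and_eq_true, decide_eq_true_eq] at hw
  obtain ⟨hdeep, hw⟩ := hw
  cases q with
  | zero => simp [pWitnessC] at hw
  | succ q =>
    obtain ⟨hprime, hq, hcount⟩ := killerB_sound V hqN
    haveI : Fact (q + 1).Prime := ⟨hprime⟩
    simp only [pWitnessC, Bool.and_eq_true, decide_eq_true_eq] at hw
    obtain ⟨hNk, hrest⟩ := hw
    split at hrest
    · exact absurd hrest Bool.false_ne_true
    · rename_i tr htr
      simp only [Bool.and_eq_true, decide_eq_true_eq] at hrest
      obtain ⟨hchain, hcoef⟩ := hrest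
      have E₁ : V.toAffine.Equation X₁ Y₁ := (Affine.equation_iff X₁ Y₁).mpr e₁
      have E₂ : V.toAffine.Equation X₂ Y₂ := (Affine.equation_iff X₂ Y₂).mpr e₂
      have E₃ : V.toAffine.Equation X₃ Y₃ := (Affine.equation_iff X₃ Y₃).mpr e₃
      simp only at hdeep
      have hu : p ^ u ∣ N / p := by
        rcases Nat.eq_zero_or_pos p with rfl | hp
        · rw [hNk]
          simp only [zero_mul, Nat.zero_div]
          exact dvd_zero _
        · obtain ⟨j, hj⟩ := hdeep
          refine ⟨j, ?_⟩
          rw [hj, pow_succ, mul_comm (p ^ u) p, mul_assoc, Nat.mul_div_cancel_left _ hp]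
      exact not_mem_pCoset_of_chain3 V (q + 1) hq (p := p) (u := u) (k := N / p)
        (by rw [hcount]; exact hNk) hu _ _ _ (reduceMod_some V (q + 1) hq E₁ _)
        (reduceMod_some V (q + 1) hq E₂ _) (reduceMod_some V (q + 1) hq E₃ _) _ hchain hcoef

/-! ### The certificate on the scaled model -/

open scoped Classical in
/-- **`p`-saturation on the integral model from deep-prime witnesses, torsion exponent `u`**:
`t = p^u · m` with `p ∤ m` kills every torsion element (`annihilatorCheck`), and every normalised
class is served by some certified prime of `Q` (`listedSpan_saturated_of_not_mem_pCoset` at `u`).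
[cite: CremonaAlgorithms1997, §3.5] -/
theorem pSaturated_of_certPU (V : WeierstrassCurve ℤ) (hΔ : V.Δ ≠ 0) {X₁ Y₁ X₂ Y₂ X₃ Y₃ : ℤ}
    (e₁ : Y₁ ^ 2 + V.a₁ * X₁ * Y₁ + V.a₃ * Y₁ = X₁ ^ 3 + V.a₂ * X₁ ^ 2 + V.a₄ * X₁ + V.a₆)
    (e₂ : Y₂ ^ 2 + V.a₁ * X₂ * Y₂ + V.a₃ * Y₂ = X₂ ^ 3 + V.a₂ * X₂ ^ 2 + V.a₄ * X₂ + V.a₆)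
    (e₃ : Y₃ ^ 2 + V.a₁ * X₃ * Y₃ + V.a₃ * Y₃ = X₃ ^ 3 + V.a₂ * X₃ ^ 2 + V.a₄ * X₃ + V.a₆)
    {p : ℕ} (hp : p.Prime) {S : List (ℕ × ℕ)} {t u m : ℕ}
    (hS : ∀ ℓN ∈ S, ℓN.1.Prime ∧
      ∀ (x : (V.map (Int.castRingHom ℚ)).toAffine.Point) (n : ℕ), ¬ ℓN.1 ∣ n → n • x = 0 →
        ℓN.2 • x = 0)
    (ht : annihilatorCheck S t = true) (htm : t = p ^ u * m) (hpm : ¬ (p : ℤ) ∣ (m : ℤ))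
    {Q : List (ℕ × ℕ)} (hQ : Q.all (killerB V) = true)
    (hall : (normTriples p).all (fun abc => Q.any (pWitnessU V p u X₁ Y₁ X₂ Y₂ X₃ Y₃ abc))
      = true) :
    ∀ x : (V.map (Int.castRingHom ℚ)).toAffine.Point,
      p • x ∈ AddSubgroup.closure
          {Affine.Point.some (X₁ : ℚ) (Y₁ : ℚ) (nonsingular_rat_of_eq V hΔ e₁),
            Affine.Point.some (X₂ : ℚ) (Y₂ : ℚ) (nonsingular_rat_of_eq V hΔ e₂),
            Affine.Point.some (X₃ : ℚ) (Y₃ : ℚ) (nonsingular_rat_of_eq V hΔ e₃)} ⊔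
          AddCommGroup.torsion _ →
      x ∈ AddSubgroup.closure
          {Affine.Point.some (X₁ : ℚ) (Y₁ : ℚ) (nonsingular_rat_of_eq V hΔ e₁),
            Affine.Point.some (X₂ : ℚ) (Y₂ : ℚ) (nonsingular_rat_of_eq V hΔ e₂),
            Affine.Point.some (X₃ : ℚ) (Y₃ : ℚ) (nonsingular_rat_of_eq V hΔ e₃)} ⊔
          AddCommGroup.torsion _ := by
  have W : ∀ {abc : ℤ × ℤ × ℤ}, abc ∈ normTriples p →
      ∃ q N, killerB V (q, N) = true ∧ pWitnessU V p u X₁ Y₁ X₂ Y₂ X₃ Y₃ abc (q, N) = true := by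
    intro abc h
    have h1 := List.all_eq_true.mp hall _ h
    obtain ⟨⟨q, N⟩, hmem, hw⟩ := List.any_eq_true.mp h1
    exact ⟨q, N, List.all_eq_true.mp hQ _ hmem, hw⟩
  refine listedSpan_saturated_of_not_mem_pCoset hp (u := u) (m := (m : ℤ))
    (isCoprime_of_prime_of_not_dvd hp hpm) ?_ (residues_of_normalised hp ?_ ?_ ?_)
  · intro x hx
    have e : ((p : ℤ) ^ u * (m : ℤ)) = ((t : ℕ) : ℤ) := by rw [htm]; push_cast; ring
    rw [e, natCast_zsmul]
    exact nsmul_eq_zero_of_annihilatorCheck hS ht hx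
  · intro b c hb hb' hc hc'
    obtain ⟨q, N, hqN, hw⟩ := W (mem_normTriples₁ hb hb' hc hc')
    have key := not_mem_pCoset_of_pWitnessU V hΔ hqN e₁ e₂ e₃ hw
    simpa only [one_smul, one_zsmul] using key
  · intro c hc hc'
    obtain ⟨q, N, hqN, hw⟩ := W (mem_normTriples₂ hc hc')
    have key := not_mem_pCoset_of_pWitnessU V hΔ hqN e₁ e₂ e₃ hw
    simpa only [zero_smul, zero_zsmul, zero_add, one_smul, one_zsmul] using key
  · obtain ⟨q, N, hqN, hw⟩ := W (mem_normTriples₃ p)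
    have key := not_mem_pCoset_of_pWitnessU V hΔ hqN e₁ e₂ e₃ hw
    simpa only [zero_smul, zero_zsmul, zero_add, one_smul, one_zsmul] using key

/-! ### The row certificate -/

/-- The lane-`u ≥ 1` row datum: the `p`-exponent `u` of the torsion annihilator and the dense
datum of `Rank2ObservatoryRank3PSatCertC` (scale, scaled generators, counts `S`, annihilator `t`,
witness primes with counts `Q`). [cite: CremonaAlgorithms1997, §3.5] -/
structure Rank3PSatCertU where
  /-- the exponent `u` with `t = p^u · m`, `p ∤ m` -/
  u : ℕ
  /-- the dense lane-0 datum -/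
  c : Rank3PSatCertC

/-- **The lane-`u ≥ 1` row Boolean** (kernel `decide`): base checks as `rank3PSatCheckC` with
`t = p^u · m`, `p ∤ m` (`m = t / p^u`) in place of `p ∤ t`; counts by `killerLB`; every normalised
class served by a DEEP prime of `Q` (`pWitnessU`). [cite: CremonaAlgorithms1997, §3.5] -/
def rank3PSatCheckU (r : Rank3Row) (p : ℕ) (cu : Rank3PSatCertU) : Bool :=
  let c := cu.c
  let V := scaleModel r.intModel c.d
  let m := c.t / p ^ cu.u
  decide (c.d ≠ 0 ∧ V.Δ ≠ 0 ∧ p.Prime ∧ c.t = p ^ cu.u * m ∧ ¬ (p : ℤ) ∣ (m : ℤ) ∧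
      c.X₁ * r.P₁.2.2 = c.d ^ 2 * r.P₁.1 ∧ c.Y₁ * r.P₁.2.2 = c.d ^ 3 * r.P₁.2.1 ∧
      c.X₂ * r.P₂.2.2 = c.d ^ 2 * r.P₂.1 ∧ c.Y₂ * r.P₂.2.2 = c.d ^ 3 * r.P₂.2.1 ∧
      c.X₃ * r.P₃.2.2 = c.d ^ 2 * r.P₃.1 ∧ c.Y₃ * r.P₃.2.2 = c.d ^ 3 * r.P₃.2.1 ∧
      c.Y₁ ^ 2 + V.a₁ * c.X₁ * c.Y₁ + V.a₃ * c.Y₁ =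
        c.X₁ ^ 3 + V.a₂ * c.X₁ ^ 2 + V.a₄ * c.X₁ + V.a₆ ∧
      c.Y₂ ^ 2 + V.a₁ * c.X₂ * c.Y₂ + V.a₃ * c.Y₂ =
        c.X₂ ^ 3 + V.a₂ * c.X₂ ^ 2 + V.a₄ * c.X₂ + V.a₆ ∧
      c.Y₃ ^ 2 + V.a₁ * c.X₃ * c.Y₃ + V.a₃ * c.Y₃ =
        c.X₃ ^ 3 + V.a₂ * c.X₃ ^ 2 + V.a₄ * c.X₃ + V.a₆) &&
  annihilatorCheck c.S c.t && c.S.all (killerLB V) && c.Q.all (killerLB V) &&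
  (normTriples p).all fun abc => c.Q.any (pWitnessU V p cu.u c.X₁ c.Y₁ c.X₂ c.Y₂ c.X₃ c.Y₃ abc)

/-- **SOUNDNESS of the lane-`u ≥ 1` row certificate**: the listed span
`ℤP₁ + ℤP₂ + ℤP₃ + E(ℚ)_tors` is `p`-SATURATED in `E(ℚ) = r.curve⟮ℚ⟯`.
[cite: CremonaAlgorithms1997, §3.5] [cite: SilvermanAEC2009, III.3.1(b)] -/
theorem Rank3Row.pSaturated_of_pSatCheckU (r : Rank3Row) (h : r.check = true) (p : ℕ)
    (cu : Rank3PSatCertU) (hc : rank3PSatCheckU r p cu = true) :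
    ∀ a : r.curve.toAffine.Point,
      p • a ∈ AddSubgroup.closure {r.gen₁ h, r.gen₂ h, r.gen₃ h} ⊔ AddCommGroup.torsion _ →
        a ∈ AddSubgroup.closure {r.gen₁ h, r.gen₂ h, r.gen₃ h} ⊔ AddCommGroup.torsion _ := by
  simp only [rank3PSatCheckU, Bool.and_eq_true, decide_eq_true_eq] at hc
  obtain ⟨⟨⟨⟨⟨hd, hΔ, hp, htm, hpm, hX₁, hY₁, hX₂, hY₂, hX₃, hY₃, e₁, e₂, e₃⟩, hann⟩, hS⟩, hQ⟩,
    hall⟩ := hc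
  exact r.pSaturated_of_scaled h hd hX₁ hY₁ hX₂ hY₂ hX₃ hY₃ hΔ e₁ e₂ e₃ p
    (pSaturated_of_certPU _ hΔ e₁ e₂ e₃ hp
      (killers_of_all_killerB _ (all_killerB_of_all_killerLB _ hS)) hann htm hpm
      (all_killerB_of_all_killerLB _ hQ) hall)

/-- The lane-`u ≥ 1` Boolean over a list of rows and certificates (same order). [folklore] -/
def rank3PSatCheckUAll (p : ℕ) : List Rank3Row → List Rank3PSatCertU → Bool
  | [], _ => true
  | _ :: _, [] => false
  | r :: rs, c :: cs => rank3PSatCheckU r p c && rank3PSatCheckUAll p rs cs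

/-- **Soundness of the list form, lane `u ≥ 1`** — the statement the data files cite.
[cite: CremonaAlgorithms1997, §3.5] -/
theorem Rank3Row.pSaturated_of_pSatCheckUAll (p : ℕ) :
    ∀ {rows : List Rank3Row} {cs : List Rank3PSatCertU}, rank3PSatCheckUAll p rows cs = true →
      ∀ r ∈ rows, ∀ h : r.check = true, ∀ a : r.curve.toAffine.Point,
        p • a ∈ AddSubgroup.closure {r.gen₁ h, r.gen₂ h, r.gen₃ h} ⊔ AddCommGroup.torsion _ →
          a ∈ AddSubgroup.closure {r.gen₁ h, r.gen₂ h, r.gen₃ h} ⊔ AddCommGroup.torsion _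
  | [], _, _ => by simp
  | _ :: _, [], hc => by simp [rank3PSatCheckUAll] at hc
  | r :: rs, c :: cs, hc => by
    rw [rank3PSatCheckUAll, Bool.and_eq_true] at hc
    intro r' hr'
    rcases List.mem_cons.mp hr' with rfl | hmem
    · exact fun h => r'.pSaturated_of_pSatCheckU h p c hc.1
    · exact Rank3Row.pSaturated_of_pSatCheckUAll p hc.2 r' hmem

end Summit.BirchSwinnertonDyer.BirchSwinnertonDyer.Rank2Observatory
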